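import Literature.NumberTheory.ModularForms.SiegelSymplecticVolume
import Mathlib.Analysis.Analytic.IsolatedZeros
import Mathlib.Analysis.Analytic.Uniqueness
import HarnessLib

/-!
# Shimura's Proposition 11, second assertion: a holomorphic function vanishing on an open piece of the
# locus `𝔜_j` vanishes identically — the identity theorem across a real form
# (Shimura 1972, §3 Prop. 11 and the «well-known facts» (i), (ii))

Topic `Literature/AlgebraicGeometry/ModuliOfAbelianVarieties` (the Siegel-family files, namespace
`Literature.AlgebraicGeometry.ModuliOfAbelianVarieties.SiegelModuli`).  Lane `lit-hodgefound`
(Track 2 foundations library), prover seat p15 generation 49, row g49-#3, complementing g48-#6/g49-#1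
(Prop. 11, first assertion: the locus `𝔜_j = {Z ∈ 𝔥_g : jZ = −Z̄j}` of an integral `j` with `j² = −1`,
`ᵗj = −j` is swept by `Z(x, y) = (x + jxj) + i(y − jyj)`) and g49-#2 (Thm. 2, the Baire form).  THIS FILE
proves the SECOND assertion of Prop. 11 — a holomorphic function on a connected domain of the Siegel
space vanishing on a non-empty open subset of the locus vanishes identically — from an abstract identity
theorem ACROSS A REAL FORM: if `c` is a continuous conjugate-linear involution of a complex normed space
`E` and an analytic `f` on a connected open `D` vanishes at the points `x₀ + v`, `c v = v`, `‖v‖ < r`,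
then `f ≡ 0` on `D`.  Shimura's «well-known facts» (i) (`E = ℂ`, `c = ρ`) and (ii) (`E = ℂ²`,
`c(z, z′) = (z′^ρ, z^ρ)`) are the two special cases he quotes; `𝔜_j` is the fixed locus of
`c_j(Z) = jZ̄j` on `Sym_g(ℂ)` (in Klingen's coordinates `Sym_g(ℂ) ≃L[ℂ] ℂ^{g(g+1)/2}` of the tree).
THEOREMS ONLY: no definition, no instance, no notation, no named fact (net Literature debt `0`), no
`sorry`.

## Source, VERBATIM

G. Shimura, *On the field of rationality for an abelian variety*, Nagoya Math. J. **45** (1972) 167–178,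
held `paper:doi-10-1017-s0027763000014720`, §3 «The even dimensional case», pp. 174–176:
«**PROPOSITION 10.** … Let `j = (0 −1_m; 1_m 0)`, and let `𝔜` be the set of all `z ∈ 𝔖_n` such that
`jz = −z^ρ j`. …»  «**PROPOSITION 11.** The set `𝔜` of Prop. 10 is non-empty.  Moreover, let `g` be a
holomorphic function defined on a connected domain `D` contained in `𝔖_n`.  If `g = 0` on a non-empty
open subset of `D ∩ 𝔜`, then `g` is identically `0` on `D`.  Proof. … Our second assertion follows from
the following well-known facts: (i) A holomorphic function `h(z)` in one complex variable `z` is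
identically `0`, if `h(x) = 0` for all real `x`. (ii) A holomorphic function `h(z, z′)` in two complex
variables `z` and `z′` is identically `0`, if `h(z, z^ρ) = 0` for all complex `z`.  Of course the
function in each case must be defined on a connected domain for which the condition `h(x) = 0` or
`h(z, z^ρ) = 0` is meaningful.»  (Here `ρ` is complex conjugation and `𝔖_n` the Siegel space of degree
`n`.)

H. Klingen, *Introductory lectures on Siegel modular forms* (CUP 1990), Ch. I §1 Def. 2 (p. 2): the
coordinates `z ↦ (z_{kl})_{k ≤ l}` of `Sym_n(ℂ)` — the tree's `coordCLE n : Sym_n(ℂ) ≃L[ℂ] (Sym2 (Fin n) → ℂ)`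
(`Literature/NumberTheory/ModularForms/SiegelSymplecticVolume`).

## The tree's rendering

* **§1 Real forms.**  For `c : E → E` additive, conjugate-linear (`c(tz) = t̄ c(z)`) and involutive on a
  complex normed space `E`, every `w` decomposes as `w = a + ib` with `c a = a`, `c b = b`:
  `a = (w + cw)/2`, `b = −(i/2)(w − cw)` (`realForm_decomposition`).
* **§2 The identity theorem across a real form** (the common mechanism of (i) and (ii)).  Let `c` be
  moreover continuous, `f : E → F` analytic at every point of the ball `B(x₀, r)`, and `f(x₀ + v) = 0`
  whenever `c v = v`, `‖v‖ < r`.  For `z = x₀ + w` near `x₀`, decompose `w = a + ib`; the one-variable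
  function `h(t) = f(x₀ + a + tb)` is analytic on `|t| < 2` and vanishes for REAL `t` (then
  `a + tb` is `c`-fixed), hence — zeros accumulating at `0`, Mathlib's one-variable identity theorem
  `AnalyticOnNhd.eqOn_zero_of_preconnected_of_frequently_eq_zero` — vanishes at `t = i`: `f(z) = 0`.
  So `f ≡ 0` near `x₀` (`eventuallyEq_zero_of_eq_zero_on_realForm`), and on a preconnected open `D`
  by the several-variable identity theorem (`eqOn_zero_of_eq_zero_on_realForm`).
* **§3 Shimura's facts (i) and (ii)**: `eqOn_zero_of_eq_zero_on_real` (`E = ℂ`, `c = conj`: vanishing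
  at the real points near a real `x₀ ∈ D` forces `f ≡ 0` on `D`) and `eqOn_zero_of_eq_zero_on_conjGraph`
  (`E = ℂ × ℂ`, `c(z, z′) = (z̄′, z̄)`: vanishing at the points `(z, z̄)` near `(z₀, z̄₀) ∈ D` forces
  `f ≡ 0`).  As printed, (i)/(ii) ask vanishing for ALL real `x` / all `z`; the local versions here are
  stronger and are what the proof of Prop. 11 uses («the condition … is meaningful»).
* **§4 Prop. 11, second assertion, for every `j`.**  On `Sym_g(ℂ)`, in Klingen's coordinates
  `v ↦ Z_v`, the map `c_j : Z ↦ jZ̄j` (`ᵗj = −j` keeps it symmetric, `isSymm_locusConj`) is a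
  continuous conjugate-linear involution whose fixed points are exactly the `Z` with `jZ = −Z̄j`
  (`locusConj_eq_self_iff`); hence (`eqOn_zero_of_eq_zero_on_locus`): if `f` is analytic on a
  preconnected open `D ⊆ ℂ^{g(g+1)/2}`, `v₀ ∈ D` lies on the locus (`jZ_{v₀} = −Z̄_{v₀}j`), and `f(v) = 0`
  for all locus points `v ∈ D` with `‖v − v₀‖ < r`, then `f ≡ 0` on `D`.  (Shimura's `D ⊂ 𝔖_n`; the
  statement holds for any connected open `D ⊆ Sym_n(ℂ)`, the positivity of `Im Z` playing no role.)
-/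

noncomputable section

open scoped Matrix ComplexConjugate Topology
open Matrix Complex Function Set Filter

namespace Literature.AlgebraicGeometry.ModuliOfAbelianVarieties

namespace SiegelModuli

open Literature.NumberTheory.ModularForms.SiegelUpperHalfSpace (coordCLE coordCLE_apply_mk
  coe_coordCLE_symm_apply)
open Literature.LinearAlgebra.Matrix (symmetricSubmodule mem_symmetricSubmodule isSymm_coe)

/-! ## §1 Real forms: `w = a + ib` with `c a = a`, `c b = b` -/

section RealForm

variable {E F : Type*} [NormedAddCommGroup E] [NormedSpace ℂ E] [NormedAddCommGroup F] [NormedSpace ℂ F]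
  {c : E → E}

/-- An additive conjugate-linear map respects subtraction. [folklore] -/
private theorem realForm_map_sub_g49c (hadd : ∀ z w, c (z + w) = c z + c w)
    (hsmul : ∀ (t : ℂ) (z : E), c (t • z) = conj t • c z) (z w : E) : c (z - w) = c z - c w := by
  rw [sub_eq_add_neg, hadd, ← neg_one_smul ℂ w, hsmul, map_neg, map_one, neg_one_smul, ← sub_eq_add_neg]

/-- **The real-form decomposition.**  For an additive, conjugate-linear, involutive `c : E → E` and any
`w ∈ E`: `a = (w + cw)/2` and `b = −(i/2)(w − cw)` are fixed by `c`, and `w = a + ib` — the abstract form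
of `z = x + iy` (fact (i)) and of `(z, z′) = ` fixed `+ i·`fixed for `c(z, z′) = (z̄′, z̄)` (fact (ii)).
[cite: Shimura1972FieldOfRationality, §3 Prop. 11 proof («well-known facts» (i), (ii)), p. 176] -/
theorem realForm_decomposition (hadd : ∀ z w, c (z + w) = c z + c w)
    (hsmul : ∀ (t : ℂ) (z : E), c (t • z) = conj t • c z) (hcc : ∀ z, c (c z) = z) (w : E) :
    c ((2⁻¹ : ℂ) • (w + c w)) = (2⁻¹ : ℂ) • (w + c w) ∧
    c ((-(Complex.I / 2)) • (w - c w)) = (-(Complex.I / 2)) • (w - c w) ∧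
    (2⁻¹ : ℂ) • (w + c w) + Complex.I • ((-(Complex.I / 2)) • (w - c w)) = w := by
  refine ⟨?_, ?_, ?_⟩
  · rw [hsmul, hadd, hcc, add_comm (c w) w, map_inv₀, map_ofNat]
  · have hconj : conj (-(Complex.I / 2)) = Complex.I / 2 := by
      rw [map_neg, map_div₀, Complex.conj_I, map_ofNat, neg_div, neg_neg]
    rw [hsmul, realForm_map_sub_g49c hadd hsmul, hcc, hconj, ← neg_sub w (c w), smul_neg, neg_smul]
  · have hI : Complex.I * (-(Complex.I / 2)) = 2⁻¹ := by
      rw [mul_neg, ← mul_div_assoc, Complex.I_mul_I]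
      norm_num
    rw [smul_smul, hI, ← smul_add, add_add_sub_cancel, ← two_smul ℂ w, smul_smul, inv_mul_cancel₀ two_ne_zero,
      one_smul]

/-! ## §2 The identity theorem across a real form -/

/-- **Local form.**  Let `c : E → E` be a continuous, additive, conjugate-linear involution, `f : E → F`
analytic at every point of `B(x₀, r)`, and `f(x₀ + v) = 0` for all `c`-fixed `v` with `‖v‖ < r`.  Then
`f` vanishes in a neighbourhood of `x₀`: for `z = x₀ + a + ib` near `x₀` (`a`, `b` fixed by `c`), the
one-variable holomorphic `h(t) = f(x₀ + a + tb)` vanishes for real `t`, hence identically (zeros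
accumulate at `0`), and `h(i) = f(z)`. [cite: Shimura1972FieldOfRationality, §3 Prop. 11 proof («(i) A holomorphic function `h(z)` in one complex variable `z` is identically `0`, if `h(x) = 0` for all real `x`»), p. 176] -/
theorem eventuallyEq_zero_of_eq_zero_on_realForm (hcont : Continuous c) (hadd : ∀ z w, c (z + w) = c z + c w)
    (hsmul : ∀ (t : ℂ) (z : E), c (t • z) = conj t • c z) (hcc : ∀ z, c (c z) = z)
    {f : E → F} {x₀ : E} {r : ℝ} (hr : 0 < r) (hf : ∀ z ∈ Metric.ball x₀ r, AnalyticAt ℂ f z)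
    (h0 : ∀ v, c v = v → ‖v‖ < r → f (x₀ + v) = 0) : f =ᶠ[𝓝 x₀] 0 := by
  have hc0 : c 0 = 0 := by simpa using hadd 0 0
  -- continuity of `c` at `0`
  obtain ⟨δ₁, hδ₁, hδ₁c⟩ := Metric.continuous_iff.1 hcont 0 (r / 4) (by positivity)
  have hδpos : 0 < min δ₁ (r / 4) := lt_min hδ₁ (by positivity)
  rw [Filter.EventuallyEq, Metric.eventually_nhds_iff]
  refine ⟨min δ₁ (r / 4), hδpos, fun z hz ↦ ?_⟩
  -- decompose `w = z − x₀ = a + ib`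
  set w : E := z - x₀ with hw
  have hwn : ‖w‖ < min δ₁ (r / 4) := by rwa [hw, ← dist_eq_norm]
  have hw₁ : ‖w‖ < δ₁ := hwn.trans_le (min_le_left _ _)
  have hw₂ : ‖w‖ < r / 4 := hwn.trans_le (min_le_right _ _)
  have hcw : ‖c w‖ < r / 4 := by
    have h := hδ₁c w (by rwa [dist_zero_right])
    rwa [hc0, dist_zero_right] at h
  obtain ⟨ha, hb, hab⟩ := realForm_decomposition hadd hsmul hcc w
  set a : E := (2⁻¹ : ℂ) • (w + c w) with ha_def
  set b : E := (-(Complex.I / 2)) • (w - c w) with hb_def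
  clear_value a b
  have han : ‖a‖ < r / 4 := by
    rw [ha_def, norm_smul, norm_inv, Complex.norm_two]
    have h := norm_add_le w (c w)
    linarith
  have hbn : ‖b‖ < r / 4 := by
    rw [hb_def, norm_smul, norm_neg, norm_div, Complex.norm_I, Complex.norm_two]
    have h := norm_sub_le w (c w)
    linarith
  -- the one-variable function `h(t) = f(x₀ + a + t b)` on `|t| < 2`
  have hmem : ∀ t : ℂ, ‖t‖ < 2 → x₀ + (a + t • b) ∈ Metric.ball x₀ r := fun t ht ↦ by
    rw [Metric.mem_ball, dist_eq_norm, add_sub_cancel_left]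
    have h1 : ‖a + t • b‖ ≤ ‖a‖ + ‖t‖ * ‖b‖ := (norm_add_le _ _).trans_eq (by rw [norm_smul t b])
    have h2 : ‖t‖ * ‖b‖ ≤ 2 * ‖b‖ := mul_le_mul_of_nonneg_right ht.le (norm_nonneg _)
    linarith
  have hT : AnalyticOnNhd ℂ (fun t : ℂ ↦ f (x₀ + (a + t • b))) (Metric.ball (0 : ℂ) 2) := fun t ht ↦ by
    have ht' : ‖t‖ < 2 := by rwa [Metric.mem_ball, dist_zero_right] at ht
    have hlin : AnalyticAt ℂ (fun t : ℂ ↦ x₀ + (a + t • b)) t :=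
      analyticAt_const.add (analyticAt_const.add ((analyticAt_id (𝕜 := ℂ)).smul analyticAt_const))
    exact AnalyticAt.comp (g := f) (f := fun t : ℂ ↦ x₀ + (a + t • b)) (hf _ (hmem t ht')) hlin
  -- it vanishes for real `t`
  have hreal : ∀ s : ℝ, |s| < 2 → f (x₀ + (a + (s : ℂ) • b)) = 0 := fun s hs ↦ by
    refine h0 _ ?_ ?_
    · rw [hadd, hsmul, ha, hb, Complex.conj_ofReal]
    · have h := hmem s (by rwa [Complex.norm_real, Real.norm_eq_abs])
      rwa [Metric.mem_ball, dist_eq_norm, add_sub_cancel_left] at h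
  -- hence its zeros accumulate at `0`
  have hfreq : ∃ᶠ t in 𝓝[≠] (0 : ℂ), f (x₀ + (a + t • b)) = 0 := by
    rw [Filter.frequently_iff]
    intro U hU
    obtain ⟨ε, hε, hεU⟩ := Metric.mem_nhdsWithin_iff.1 hU
    have hpos : 0 < min (ε / 2) 1 := by positivity
    refine ⟨((min (ε / 2) 1 : ℝ) : ℂ), hεU ⟨?_, ?_⟩, hreal _ ?_⟩
    · rw [Metric.mem_ball, dist_zero_right, Complex.norm_real, Real.norm_eq_abs, abs_of_pos hpos]
      exact (min_le_left _ _).trans_lt (by linarith)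
    · rw [Set.mem_compl_iff, Set.mem_singleton_iff, Complex.ofReal_eq_zero]
      exact hpos.ne'
    · rw [abs_of_pos hpos]
      exact (min_le_right _ _).trans_lt one_lt_two
  -- so it vanishes on `|t| < 2`, in particular at `t = i`
  have hzero := hT.eqOn_zero_of_preconnected_of_frequently_eq_zero (convex_ball (0 : ℂ) 2).isPreconnected
    (Metric.mem_ball_self two_pos) hfreq
  have hI : f (x₀ + (a + Complex.I • b)) = 0 :=
    hzero (by rw [Metric.mem_ball, dist_zero_right, Complex.norm_I]; norm_num)
  have hz : x₀ + (a + Complex.I • b) = z := by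
    rw [hab, hw, add_sub_cancel]
  rw [hz] at hI
  exact hI

/-- **The identity theorem across a real form.**  Let `c : E → E` be a continuous, additive,
conjugate-linear involution of a complex normed space, `D ⊆ E` open and preconnected, `f : E → F`
analytic on `D`, `x₀ ∈ D`, and suppose `f(x₀ + v) = 0` for all `c`-fixed `v` with `‖v‖ < r` and
`x₀ + v ∈ D`.  Then `f ≡ 0` on `D` («the function in each case must be defined on a connected domain for
which the condition … is meaningful»). [cite: Shimura1972FieldOfRationality, §3 Prop. 11 (second assertion) and its proof (facts (i), (ii)), pp. 175–176] -/
theorem eqOn_zero_of_eq_zero_on_realForm (hcont : Continuous c) (hadd : ∀ z w, c (z + w) = c z + c w)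
    (hsmul : ∀ (t : ℂ) (z : E), c (t • z) = conj t • c z) (hcc : ∀ z, c (c z) = z)
    {f : E → F} {D : Set E} (hD : IsOpen D) (hDc : IsPreconnected D) (hf : AnalyticOnNhd ℂ f D)
    {x₀ : E} (hx₀ : x₀ ∈ D) {r : ℝ} (hr : 0 < r)
    (h0 : ∀ v, c v = v → ‖v‖ < r → x₀ + v ∈ D → f (x₀ + v) = 0) : EqOn f 0 D := by
  obtain ⟨ρ, hρ, hball⟩ := Metric.isOpen_iff.1 hD x₀ hx₀
  refine hf.eqOn_zero_of_preconnected_of_eventuallyEq_zero hDc hx₀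
    (eventuallyEq_zero_of_eq_zero_on_realForm hcont hadd hsmul hcc (lt_min hr hρ)
      (fun z hz ↦ hf z (hball (Metric.ball_subset_ball (min_le_right _ _) hz))) fun v hv hvn ↦ ?_)
  have hvD : x₀ + v ∈ D := hball (by
    rw [Metric.mem_ball, dist_eq_norm, add_sub_cancel_left]
    exact hvn.trans_le (min_le_right _ _))
  exact h0 v hv (hvn.trans_le (min_le_left _ _)) hvD

end RealForm

/-! ## §3 Shimura's «well-known facts» (i) and (ii) -/

section Facts

variable {F : Type*} [NormedAddCommGroup F] [NormedSpace ℂ F]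

/-- **Fact (i)**: «A holomorphic function `h(z)` in one complex variable `z` is identically `0`, if
`h(x) = 0` for all real `x`» — local form: `f` analytic on a preconnected open `D ⊆ ℂ` containing the
real point `x₀`, `f(x) = 0` for the real `x ∈ D` with `|x − x₀| < r` ⟹ `f ≡ 0` on `D`.
[cite: Shimura1972FieldOfRationality, §3 Prop. 11 proof, fact (i), p. 176] -/
theorem eqOn_zero_of_eq_zero_on_real {f : ℂ → F} {D : Set ℂ} (hD : IsOpen D) (hDc : IsPreconnected D)
    (hf : AnalyticOnNhd ℂ f D) {x₀ : ℝ} (hx₀ : (x₀ : ℂ) ∈ D) {r : ℝ} (hr : 0 < r)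
    (h0 : ∀ x : ℝ, |x - x₀| < r → (x : ℂ) ∈ D → f x = 0) : EqOn f 0 D := by
  refine eqOn_zero_of_eq_zero_on_realForm (c := fun z : ℂ ↦ conj z) Complex.continuous_conj
    (fun z w ↦ map_add _ z w) (fun t z ↦ by rw [smul_eq_mul, smul_eq_mul, map_mul]) Complex.conj_conj hD hDc
    hf hx₀ hr fun v hv hvn hvD ↦ ?_
  have hvre : (v.re : ℂ) = v := Complex.conj_eq_iff_re.1 hv
  have hx : (x₀ : ℂ) + v = ((x₀ + v.re : ℝ) : ℂ) := by rw [Complex.ofReal_add, hvre]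
  rw [hx] at hvD ⊢
  refine h0 _ ?_ hvD
  rw [add_sub_cancel_left]
  exact (Complex.abs_re_le_norm v).trans_lt hvn

/-- **Fact (ii)**: «A holomorphic function `h(z, z′)` in two complex variables `z` and `z′` is identically
`0`, if `h(z, z^ρ) = 0` for all complex `z`» — local form: `f` analytic on a preconnected open
`D ⊆ ℂ × ℂ` containing `(z₀, z̄₀)`, `f(z, z̄) = 0` for `(z, z̄) ∈ D` with `‖z − z₀‖ < r` ⟹ `f ≡ 0` on `D`
(the real form of `c(z, z′) = (z̄′, z̄)` is the graph `{(z, z̄)}` of conjugation).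
[cite: Shimura1972FieldOfRationality, §3 Prop. 11 proof, fact (ii), p. 176] -/
theorem eqOn_zero_of_eq_zero_on_conjGraph {f : ℂ × ℂ → F} {D : Set (ℂ × ℂ)} (hD : IsOpen D)
    (hDc : IsPreconnected D) (hf : AnalyticOnNhd ℂ f D) {z₀ : ℂ} (hz₀ : (z₀, conj z₀) ∈ D) {r : ℝ} (hr : 0 < r)
    (h0 : ∀ z : ℂ, ‖z - z₀‖ < r → (z, conj z) ∈ D → f (z, conj z) = 0) : EqOn f 0 D := by
  refine eqOn_zero_of_eq_zero_on_realForm (c := fun p : ℂ × ℂ ↦ (conj p.2, conj p.1)) ?_ ?_ ?_ ?_ hD hDc hf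
    hz₀ hr ?_
  · exact (Complex.continuous_conj.comp continuous_snd).prodMk (Complex.continuous_conj.comp continuous_fst)
  · intro z w
    ext <;> simp
  · intro t z
    ext <;> simp
  · intro z
    simp
  · intro v hv hvn hvD
    have hv2 : v.2 = conj v.1 := by
      have h := congrArg Prod.snd hv
      exact h.symm
    have hp : ((z₀, conj z₀) : ℂ × ℂ) + v = (z₀ + v.1, conj (z₀ + v.1)) := by
      ext
      · rfl
      · rw [Prod.snd_add, hv2, map_add]
    rw [hp] at hvD ⊢
    refine h0 _ ?_ hvD
    rw [add_sub_cancel_left]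
    exact (norm_fst_le v).trans_lt hvn

end Facts

/-! ## §4 Prop. 11, second assertion, for every `j`: the locus `𝔜_j` is the fixed set of the involution
`c_j(Z) = jZ̄j` of `Sym_g(ℂ)`, and a holomorphic function vanishing on an open piece of it vanishes -/

section Locus

variable {g : ℕ} {j : Matrix (Fin g) (Fin g) ℤ}

/-- Products of integer matrices cast to a ring. [folklore] -/
private theorem map_intCast_mul_g49c {l m n R : Type*} [Fintype m] [Ring R] (A : Matrix l m ℤ)
    (B : Matrix m n ℤ) : (A * B).map (Int.cast : ℤ → R) = A.map (Int.cast : ℤ → R) * B.map (Int.cast : ℤ → R) :=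
  Matrix.map_mul (f := Int.castRingHom R)

/-- `j² = −1` survives the cast to `ℂ`. [folklore] -/
private theorem map_intCast_mul_self_g49c (hjj : j * j = -1) :
    j.map (Int.cast : ℤ → ℂ) * j.map (Int.cast : ℤ → ℂ) = -1 := by
  rw [← map_intCast_mul_g49c, hjj]
  ext i k
  simp [Matrix.map_apply, Matrix.neg_apply, Matrix.one_apply, apply_ite]

/-- `ᵗj = −j` survives the cast to `ℂ`. [folklore] -/
private theorem transpose_map_intCast_g49c (hjT : jᵀ = -j) :
    (j.map (Int.cast : ℤ → ℂ))ᵀ = -j.map (Int.cast : ℤ → ℂ) := by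
  rw [← Matrix.transpose_map, hjT]
  ext i k
  simp [Matrix.map_apply]

/-- An integer matrix is entrywise real: `J̄ = J`. [folklore] -/
private theorem map_conj_map_intCast_g49c : (j.map (Int.cast : ℤ → ℂ)).map conj = j.map (Int.cast : ℤ → ℂ) := by
  ext i k
  simp [Matrix.map_apply]

/-- **`c_j(Z) = jZ̄j` preserves symmetric matrices** (`ᵗj = −j`): for `ᵗW = W`, `ᵗ(jW̄j) = jW̄j`.
[cite: Shimura1972FieldOfRationality, §3 Prop. 10–11 (`𝔜 ⊂ 𝔖_n`, `jz = −z^ρ j`), pp. 174–176] -/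
theorem isSymm_locusConj (hjT : jᵀ = -j) {W : Matrix (Fin g) (Fin g) ℂ} (hW : W.IsSymm) :
    (j.map (Int.cast : ℤ → ℂ) * W.map conj * j.map (Int.cast : ℤ → ℂ)).IsSymm := by
  have hWc : (W.map conj)ᵀ = W.map conj := by
    rw [← Matrix.transpose_map, hW.eq]
  unfold Matrix.IsSymm
  rw [Matrix.transpose_mul, Matrix.transpose_mul, hWc, transpose_map_intCast_g49c hjT]
  simp only [Matrix.neg_mul, Matrix.mul_neg, neg_neg, Matrix.mul_assoc]

/-- `c_j` is an involution on matrices: `j (conj (jW̄j)) j = W` (`j² = −1`, `j` real).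
[cite: Shimura1972FieldOfRationality, §3 Prop. 10 («`λ^ρ ∘ λ = −1`», `j² = −1`), pp. 174–175] -/
theorem locusConj_locusConj (hjj : j * j = -1) (W : Matrix (Fin g) (Fin g) ℂ) :
    j.map (Int.cast : ℤ → ℂ) * (j.map (Int.cast : ℤ → ℂ) * W.map conj * j.map (Int.cast : ℤ → ℂ)).map conj *
        j.map (Int.cast : ℤ → ℂ) = W := by
  set J := j.map (Int.cast : ℤ → ℂ) with hJ
  have hJJ : J * J = -1 := map_intCast_mul_self_g49c hjj
  have hc : (J * W.map conj * J).map conj = J * W * J := by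
    have hWcc : (W.map conj).map conj = W := by
      ext i k
      simp [Matrix.map_apply]
    have hJc : J.map conj = J := map_conj_map_intCast_g49c
    rw [← RingHom.mapMatrix_apply, map_mul, map_mul]
    simp only [RingHom.mapMatrix_apply, hJc, hWcc]
  rw [hc]
  have e : J * (J * W * J) * J = (J * J) * W * (J * J) := by simp only [Matrix.mul_assoc]
  rw [e, hJJ]
  simp only [Matrix.neg_mul, Matrix.one_mul, Matrix.mul_neg, Matrix.mul_one, neg_neg]

/-- **The fixed points of `c_j` are the locus**: `jW̄j = W ⟺ jW = −W̄j` (`j² = −1`) — `𝔜_j` is the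
fixed set of the anti-holomorphic involution `Z ↦ jZ̄j` of `Sym_g(ℂ)` (restricted to `𝔥_g`).
[cite: Shimura1972FieldOfRationality, §3 Prop. 10 (definition of `𝔜`: «`jz = −z^ρ j`»), p. 174] -/
theorem locusConj_eq_self_iff (hjj : j * j = -1) {W : Matrix (Fin g) (Fin g) ℂ} :
    j.map (Int.cast : ℤ → ℂ) * W.map conj * j.map (Int.cast : ℤ → ℂ) = W ↔
      j.map (Int.cast : ℤ → ℂ) * W = -W.map conj * j.map (Int.cast : ℤ → ℂ) := by
  set J := j.map (Int.cast : ℤ → ℂ) with hJ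
  have hJJ : J * J = -1 := map_intCast_mul_self_g49c hjj
  constructor
  · intro h
    calc J * W = J * (J * W.map conj * J) := by rw [h]
      _ = J * J * W.map conj * J := by simp only [Matrix.mul_assoc]
      _ = -W.map conj * J := by rw [hJJ, Matrix.neg_mul, Matrix.one_mul]
  · intro h
    have e : W.map conj * J = -(J * W) := by rw [h, Matrix.neg_mul, neg_neg]
    rw [Matrix.mul_assoc, e, Matrix.mul_neg, ← Matrix.mul_assoc, hJJ, Matrix.neg_mul, Matrix.one_mul, neg_neg]

variable {F : Type*} [NormedAddCommGroup F] [NormedSpace ℂ F]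

/-- **PROPOSITION 11, second assertion, for every `j`** (in Klingen's coordinates `v ↦ Z_v` of
`Sym_g(ℂ) ≅ ℂ^{g(g+1)/2}`): let `j` be integral with `j² = −1`, `ᵗj = −j`; let `D ⊆ ℂ^{g(g+1)/2}` be open
and preconnected, `f` analytic on `D`, `v₀ ∈ D` a point of the locus (`jZ_{v₀} = −Z̄_{v₀}j`), and suppose
`f(v) = 0` for every locus point `v ∈ D` (`jZ_v = −Z̄_vj`) with `‖v − v₀‖ < r`.  Then `f ≡ 0` on `D`
(«If `g = 0` on a non-empty open subset of `D ∩ 𝔜`, then `g` is identically `0` on `D`»; Shimura's `D`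
lies in `𝔖_n`, which is not needed). [cite: Shimura1972FieldOfRationality, §3 Prop. 11 (second assertion), pp. 175–176] [cite: Klingen1990, Ch. I §1 Def. 2 (the coordinates `z_{kl}`, `k ≤ l`), p. 2] -/
theorem eqOn_zero_of_eq_zero_on_locus (hjj : j * j = -1) (hjT : jᵀ = -j)
    {f : (Sym2 (Fin g) → ℂ) → F} {D : Set (Sym2 (Fin g) → ℂ)} (hD : IsOpen D) (hDc : IsPreconnected D)
    (hf : AnalyticOnNhd ℂ f D) {v₀ : Sym2 (Fin g) → ℂ} (hv₀ : v₀ ∈ D)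
    (hv₀Y : j.map (Int.cast : ℤ → ℂ) * ((coordCLE g).symm v₀ : Matrix (Fin g) (Fin g) ℂ) =
      -((coordCLE g).symm v₀ : Matrix (Fin g) (Fin g) ℂ).map conj * j.map (Int.cast : ℤ → ℂ))
    {r : ℝ} (hr : 0 < r)
    (h0 : ∀ v ∈ D, ‖v - v₀‖ < r →
      j.map (Int.cast : ℤ → ℂ) * ((coordCLE g).symm v : Matrix (Fin g) (Fin g) ℂ) =
        -((coordCLE g).symm v : Matrix (Fin g) (Fin g) ℂ).map conj * j.map (Int.cast : ℤ → ℂ) → f v = 0) :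
    EqOn f 0 D := by
  set J := j.map (Int.cast : ℤ → ℂ) with hJ
  -- the conjugation `c_j` in coordinates
  set c : (Sym2 (Fin g) → ℂ) → (Sym2 (Fin g) → ℂ) := fun v ↦
    coordCLE g ⟨J * ((coordCLE g).symm v : Matrix (Fin g) (Fin g) ℂ).map conj * J,
      mem_symmetricSubmodule.2 (isSymm_locusConj hjT (isSymm_coe _))⟩ with hc
  have hc_apply : ∀ v i k, c v s(i, k) = (J * ((coordCLE g).symm v : Matrix (Fin g) (Fin g) ℂ).map conj * J) i k :=
    fun v i k ↦ rfl
  -- the symmetric matrix of `c v`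
  have hc_symm : ∀ v, ((coordCLE g).symm (c v) : Matrix (Fin g) (Fin g) ℂ) =
      J * ((coordCLE g).symm v : Matrix (Fin g) (Fin g) ℂ).map conj * J := fun v ↦ by
    rw [hc]
    dsimp only
    rw [ContinuousLinearEquiv.symm_apply_apply]
  have hcont : Continuous c := by
    refine (coordCLE g).continuous.comp (Continuous.subtype_mk ?_ _)
    exact (continuous_const.matrix_mul
      ((continuous_subtype_val.comp (coordCLE g).symm.continuous).matrix_map Complex.continuous_conj)).matrix_mul
      continuous_const
  have hadd : ∀ v w, c (v + w) = c v + c w := fun v w ↦ by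
    ext s
    induction s using Sym2.ind with
    | h i k =>
      rw [Pi.add_apply, hc_apply, hc_apply, hc_apply, map_add, Submodule.coe_add,
        Matrix.map_add _ (map_add _), Matrix.mul_add, Matrix.add_mul, Matrix.add_apply]
  have hsmul : ∀ (t : ℂ) v, c (t • v) = conj t • c v := fun t v ↦ by
    ext s
    induction s using Sym2.ind with
    | h i k =>
      have hm : ((t • (coordCLE g).symm v : symmetricSubmodule (Fin g) ℂ) : Matrix (Fin g) (Fin g) ℂ).map conj =
          conj t • ((coordCLE g).symm v : Matrix (Fin g) (Fin g) ℂ).map conj := by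
        rw [Submodule.coe_smul]
        ext a b
        simp [Matrix.map_apply]
      rw [Pi.smul_apply, hc_apply, hc_apply, map_smul, hm, Matrix.mul_smul, Matrix.smul_mul, Matrix.smul_apply]
  have hcc : ∀ v, c (c v) = v := fun v ↦ by
    ext s
    induction s using Sym2.ind with
    | h i k =>
      rw [hc_apply, hc_symm, locusConj_locusConj hjj, coe_coordCLE_symm_apply]
  -- fixed points of `c` = the locus
  have hfix : ∀ v, c v = v ↔ J * ((coordCLE g).symm v : Matrix (Fin g) (Fin g) ℂ) =
      -((coordCLE g).symm v : Matrix (Fin g) (Fin g) ℂ).map conj * J := fun v ↦ by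
    rw [← locusConj_eq_self_iff hjj]
    constructor
    · intro h
      rw [← hc_symm, h]
    · intro h
      have e : c v = coordCLE g ((coordCLE g).symm v) := by
        rw [hc]
        dsimp only
        congr 1
        exact Subtype.ext h
      rw [e, ContinuousLinearEquiv.apply_symm_apply]
  refine eqOn_zero_of_eq_zero_on_realForm hcont hadd hsmul hcc hD hDc hf hv₀ hr fun v hv hvn hvD ↦ ?_
  refine h0 _ hvD (by rwa [add_sub_cancel_left]) ?_
  rw [← hfix, hadd, (hfix v₀).2 hv₀Y, hv]

end Locus

end SiegelModuli

end Literature.AlgebraicGeometry.ModuliOfAbelianVarieties
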